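import Literature.Topology.FourManifolds.KirbyMovesSlideSweepExchange3
import HarnessLib

/-!
# Rotating the meridian slice: the planar sweep about an arbitrary axis

Topic `Literature/Topology/FourManifolds`; fact seat `provefact-IsStrictHandleSlide.isSurgery`
(R. C. Kirby, *The Topology of 4-Manifolds*, LNM 1374 (1989), Ch. I §4, Fig. 4.2; remaining content:
the named fact (S) `Literature.Topology.FourManifolds.FramedLink.IsStrictHandleSlide.slideModel`).
The planar sweep (`SlideSweep.exists_planarSweep_fix`) twists about the positive first axis;
in the surgered tube the axis of the slide (the bisector `φ` of the two tips, `SlideSetup2`) is an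
arbitrary direction of the meridian slice. We provide the rotation `planeRot φ` of
`EuclideanSpace ℝ (Fin 2)` as a continuous linear equivalence and as a diffeomorphism
(`planeRotDiffeo`), its action on polar points and its norm preservation, and the **rotated
planar sweep** `exists_planarSweep_rot`: the isotopy `σ.transfer (planeRotDiffeo φ)` moves the
rotated arcs, fixes the rotated half planes at all radii, and is stationary off the same disc.

## References

* R. C. Kirby, *The Topology of 4-Manifolds*, LNM 1374, Springer (1989), Ch. I §4. [Kirby1989]
-/

open scoped Manifold ContDiff Topology
open Function Set Metric Real

noncomputable section

namespace Literature.Topology.FourManifolds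

namespace SlideSweep

/-- The planar point with coordinates `(a, b)`. [folklore] -/
def pl (a b : ℝ) : EuclideanSpace ℝ (Fin 2) := a • EuclideanSpace.single 0 1 + b • EuclideanSpace.single 1 1

/-- `pl_apply_zero` (auxiliary). [folklore] -/
@[simp] theorem pl_apply_zero (a b : ℝ) : pl a b 0 = a := by simp [pl]
/-- `pl_apply_one` (auxiliary). [folklore] -/
@[simp] theorem pl_apply_one (a b : ℝ) : pl a b 1 = b := by simp [pl]

/-- `pl_eq` (auxiliary). [folklore] -/
theorem pl_eq (z : EuclideanSpace ℝ (Fin 2)) : pl (z 0) (z 1) = z := by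
  ext i; fin_cases i <;> simp [pl]

/-- `pl_add` (auxiliary). [folklore] -/
theorem pl_add (a b a' b' : ℝ) : pl a b + pl a' b' = pl (a + a') (b + b') := by
  simp only [pl, add_smul]; abel

/-- `smul_pl` (auxiliary). [folklore] -/
theorem smul_pl (r a b : ℝ) : r • pl a b = pl (r * a) (r * b) := by
  simp only [pl, smul_add, smul_smul]

/-- `norm_pl` (auxiliary). [folklore] -/
theorem norm_pl (a b : ℝ) : ‖pl a b‖ = Real.sqrt (a ^ 2 + b ^ 2) := by
  rw [EuclideanSpace.norm_eq, Fin.sum_univ_two, pl_apply_zero, pl_apply_one, Real.norm_eq_abs, Real.norm_eq_abs,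
    sq_abs, sq_abs]

/-- **The rotation by `φ`** as a linear map. [folklore] -/
def planeRotLin (φ : ℝ) : EuclideanSpace ℝ (Fin 2) →ₗ[ℝ] EuclideanSpace ℝ (Fin 2) where
  toFun z := pl (Real.cos φ * z 0 - Real.sin φ * z 1) (Real.sin φ * z 0 + Real.cos φ * z 1)
  map_add' z w := by
    rw [pl_add]; congr 1 <;> simp <;> ring
  map_smul' r z := by
    rw [RingHom.id_apply, smul_pl]; congr 1 <;> simp <;> ring

/-- `planeRotLin_apply` (auxiliary). [folklore] -/
theorem planeRotLin_apply (φ : ℝ) (z : EuclideanSpace ℝ (Fin 2)) :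
    planeRotLin φ z = pl (Real.cos φ * z 0 - Real.sin φ * z 1) (Real.sin φ * z 0 + Real.cos φ * z 1) := rfl

/-- `planeRotLin_comp` (auxiliary). [folklore] -/
theorem planeRotLin_comp (φ ψ : ℝ) (z : EuclideanSpace ℝ (Fin 2)) :
    planeRotLin φ (planeRotLin ψ z) = planeRotLin (φ + ψ) z := by
  rw [planeRotLin_apply, planeRotLin_apply, planeRotLin_apply, pl_apply_zero, pl_apply_one, Real.cos_add, Real.sin_add]
  congr 1 <;> ring

/-- `planeRotLin_zero` (auxiliary). [folklore] -/
theorem planeRotLin_zero (z : EuclideanSpace ℝ (Fin 2)) : planeRotLin 0 z = z := by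
  rw [planeRotLin_apply, Real.cos_zero, Real.sin_zero]; simp [pl_eq]

/-- **The rotation by `φ`** as a continuous linear equivalence. [folklore] -/
def planeRot (φ : ℝ) : EuclideanSpace ℝ (Fin 2) ≃L[ℝ] EuclideanSpace ℝ (Fin 2) :=
  LinearEquiv.toContinuousLinearEquiv
    { planeRotLin φ with
      invFun := planeRotLin (-φ)
      left_inv := fun z ↦ by
        show planeRotLin (-φ) (planeRotLin φ z) = z
        rw [planeRotLin_comp, neg_add_cancel, planeRotLin_zero]
      right_inv := fun z ↦ by
        show planeRotLin φ (planeRotLin (-φ) z) = z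
        rw [planeRotLin_comp, add_neg_cancel, planeRotLin_zero] }

/-- `planeRot_apply` (auxiliary). [folklore] -/
theorem planeRot_apply (φ : ℝ) (z : EuclideanSpace ℝ (Fin 2)) :
    planeRot φ z = pl (Real.cos φ * z 0 - Real.sin φ * z 1) (Real.sin φ * z 0 + Real.cos φ * z 1) := rfl

/-- `planeRot_symm_apply` (auxiliary). [folklore] -/
theorem planeRot_symm_apply (φ : ℝ) (z : EuclideanSpace ℝ (Fin 2)) : (planeRot φ).symm z = planeRot (-φ) z := rfl

/-- **Rotating a polar point**: `Rot_φ (r (cos θ, sin θ)) = r (cos (θ + φ), sin (θ + φ))`. [folklore] -/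
theorem planeRot_polar (φ r θ : ℝ) : planeRot φ (pl (r * Real.cos θ) (r * Real.sin θ)) =
    pl (r * Real.cos (θ + φ)) (r * Real.sin (θ + φ)) := by
  rw [planeRot_apply, pl_apply_zero, pl_apply_one, Real.cos_add, Real.sin_add]
  congr 1 <;> ring

/-- The rotation preserves the norm. [folklore] -/
theorem norm_planeRot (φ : ℝ) (z : EuclideanSpace ℝ (Fin 2)) : ‖planeRot φ z‖ = ‖z‖ := by
  rw [← pl_eq z, planeRot_apply, pl_apply_zero, pl_apply_one, norm_pl, norm_pl]
  congr 1
  have := Real.sin_sq_add_cos_sq φ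
  nlinarith [this]

/-- **The rotation as a diffeomorphism of the plane.** [folklore] -/
def planeRotDiffeo (φ : ℝ) :
    EuclideanSpace ℝ (Fin 2) ≃ₘ⟮𝓘(ℝ, EuclideanSpace ℝ (Fin 2)), 𝓘(ℝ, EuclideanSpace ℝ (Fin 2))⟯ EuclideanSpace ℝ (Fin 2) :=
  (planeRot φ).toDiffeomorph

/-- `planeRotDiffeo_apply` (auxiliary). [folklore] -/
@[simp] theorem planeRotDiffeo_apply (φ : ℝ) (z : EuclideanSpace ℝ (Fin 2)) : planeRotDiffeo φ z = planeRot φ z := rfl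

/-- `planeRotDiffeo_symm_apply` (auxiliary). [folklore] -/
@[simp] theorem planeRotDiffeo_symm_apply (φ : ℝ) (z : EuclideanSpace ℝ (Fin 2)) :
    (planeRotDiffeo φ).symm z = planeRot (-φ) z := by
  show (planeRot φ).toDiffeomorph.symm z = _
  rw [ContinuousLinearEquiv.coe_toDiffeomorph_symm]; rfl

/-- **The rotated planar sweep.** The planar sweep of `exists_planarSweep_fix` for the axis at
angle `φ`: with `σφ := σ.transfer (planeRotDiffeo φ)` and `Λφ := Rot_φ ∘ Λ⁻¹`, the isotopy `σφ`
is stationary off the disc of radius `ρ + m`, carries `Λφ (g₂ y, y)` to `Λφ (g₁ y, y)` for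
`|y| ≤ Y`, and fixes `Λφ w` for all `w` with `Y ≤ |w 1|` at all times. [cite: Kirby1989, Ch. I §4] -/
theorem exists_planarSweep_rot (φ c : ℝ) {Y ρ m : ℝ} (hY : 0 ≤ Y) (hYρ : Y ≤ ρ) (hm : 0 < m) {g₁ g₂ : ℝ → ℝ}
    (hg₁ : ContDiff ℝ ∞ g₁) (hg₂ : ContDiff ℝ ∞ g₂) (heq : ∀ y, Y ≤ |y| → g₁ y = g₂ y)
    (hbound : ∀ y, |y| ≤ Y → ∀ θ ∈ Icc (0 : ℝ) 1, (g₂ y + θ * (g₁ y - g₂ y)) ^ 2 + y ^ 2 ≤ ρ ^ 2) :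
    ∃ (Λ : EuclideanSpace ℝ (Fin 2) ≃ₘ⟮𝓘(ℝ, EuclideanSpace ℝ (Fin 2)), 𝓘(ℝ, EuclideanSpace ℝ (Fin 2))⟯ EuclideanSpace ℝ (Fin 2))
      (σ : AmbientIsotopy 𝓘(ℝ, EuclideanSpace ℝ (Fin 2)) (EuclideanSpace ℝ (Fin 2))),
      (∀ (r a b : ℝ), 0 ≤ r → r ≤ ρ + 2 * m → a ^ 2 + b ^ 2 = 1 →
        Λ.symm (pl (r * a) (r * b)) =
          pl (r * (((1 + a) - Real.exp (-(c * r)) ^ 2 * (1 - a)) / ((1 + a) + Real.exp (-(c * r)) ^ 2 * (1 - a))))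
            (r * (2 * Real.exp (-(c * r)) * b / ((1 + a) + Real.exp (-(c * r)) ^ 2 * (1 - a))))) ∧
      (∀ z : EuclideanSpace ℝ (Fin 2), ‖z‖ ≤ ρ + 2 * m → ‖Λ.symm z‖ = ‖z‖) ∧
      (∀ t (z : EuclideanSpace ℝ (Fin 2)), ρ + m ≤ ‖z‖ → σ.toFun t z = z) ∧
      (∀ y : ℝ, |y| ≤ Y → σ.toFun 1 (planeRot φ (Λ.symm (pl (g₂ y) y))) = planeRot φ (Λ.symm (pl (g₁ y) y))) ∧
      (∀ w : EuclideanSpace ℝ (Fin 2), Y ≤ |w 1| → ∀ t, σ.toFun t (planeRot φ (Λ.symm w)) = planeRot φ (Λ.symm w)) := by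
  obtain ⟨Λ, σ, hfwd, hbwd, hnorm, hstat, hmove, -, hfix⟩ := exists_planarSweep_fix c hY hYρ hm hg₁ hg₂ heq hbound
  refine ⟨Λ, σ.transfer (planeRotDiffeo φ), fun r a b hr hr' hab ↦ hbwd r a b hr hr' hab, fun z hz ↦ (hnorm z hz).2,
    fun t z hz ↦ ?_, fun y hy ↦ ?_, fun w hw t ↦ ?_⟩
  · rw [AmbientIsotopy.transfer_toFun, planeRotDiffeo_symm_apply, planeRotDiffeo_apply,
      hstat t _ (by rwa [norm_planeRot])]
    show planeRot φ (planeRot (-φ) z) = z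
    exact (planeRot φ).apply_symm_apply z
  · rw [AmbientIsotopy.transfer_toFun, planeRotDiffeo_symm_apply, planeRotDiffeo_apply]
    congr 1
    have h1 : planeRot (-φ) (planeRot φ (Λ.symm (pl (g₂ y) y))) = Λ.symm (pl (g₂ y) y) :=
      (planeRot φ).symm_apply_apply _
    rw [h1]
    have := hmove y hy
    simpa [pl] using this
  · rw [AmbientIsotopy.transfer_toFun, planeRotDiffeo_symm_apply, planeRotDiffeo_apply]
    congr 1
    have h1 : planeRot (-φ) (planeRot φ (Λ.symm w)) = Λ.symm w := (planeRot φ).symm_apply_apply _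
    rw [h1]
    exact hfix w hw t

end SlideSweep

end Literature.Topology.FourManifolds
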